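import Summits.BirchSwinnertonDyer.BirchSwinnertonDyer.Theses.SignedLowerHalves
import Summits.BirchSwinnertonDyer.BirchSwinnertonDyer.Theorems.SignedLowerHalvesKobayashiMainConjectureSmallImageAcnsCrux
import Summits.BirchSwinnertonDyer.BirchSwinnertonDyer.Theorems.SignedLowerHalvesKobayashiMainConjectureSmallImageAcanchorGlueRatRatNotCMCoprime
import Summits.BirchSwinnertonDyer.BirchSwinnertonDyer.Theorems.SignedLowerHalvesKobayashiMainConjectureSmallImageCycWindingMuThree
import Summits.BirchSwinnertonDyer.BirchSwinnertonDyer.Theorems.SignedLowerHalvesKobayashiMainConjectureSmallImagePublishedInputsNsOfFiveOfMazur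
import Summits.BirchSwinnertonDyer.BirchSwinnertonDyer.Theorems.SignedLowerHalvesKobayashiLowerHalfLargeImageHorocycleMuFloor
import HarnessLib

/-!
# Sketch (LEAD bsd-line-slh-p3 gen 11, for the pen's turnkey #2 **v3**): GLUED SPLIT of crux 4 `KobayashiMainConjectureSmallImage`
# (stmt-BirchSwinnertonDyer-19002, layer 1) into the registered line `birth_acns` **v13** (Lines/birth_acns.lean sha16 8959f4935fd86146)
# stubs as items — children = v13 stub statements VERBATIM (fully qualified); glue = v13 composition re-threaded over hypotheses, sorry-free.

v3 − v2 (pen g35's `Split19002v2Sketch.lean` 394a75cd27561445, keyed to v11): (a) children 1/2 carry the v13 binder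
`¬ p ∣ NumberField.classNumber K →` after `κ₂.IsAnticyclotomic →` (vet bsd-vet-k3c4-eng rider (R); names `…Coprime`); (b) child 4 is the
v12/v13 registered stub `stub_lambdaLowerThree_ns` (p-inverted λ-part at 3, both signs; name `SmallImageLambdaLowerAtThree`) — the v11
integral `∃ ε` half is DERIVED inside the glue (`HorocycleMuFloor.X7.exists_kobayashiLowerDivisibility_three_of_pInverted` + Mazur's h3 from
child 5); (c) child 5's published half gains the 3rd conjunct `Literature.NumberTheory.QuadraticFields.BRR2022_thm_1`, consumed by the v13 glue
`SmallImageAcanchorGlueRatRatNotCMCoprime.canonicalNs_of_eulerSystemRatNotCMCoprime_of_acDivRatNotCMCoprime_noSurj` (p656230). k = 5.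
IMPORTS for the route edit (vet rider (M)): the children texts need the modules that declare `ZpExtension.IsTopGeneratorPair`, `unrIntegers`,
`IsKatzMeasure₂`, `IsGreenbergLFunctionAnyRoot₂`, `XGr₂.charIdeal`, `UnrSeries₂.minus`, the Kobayashi2003 / BCS25 / BSTW24-PRE facts AND (new in v3)
`Literature.NumberTheory.QuadraticFields.HurwitzClassNumberCongruences` (`BRR2022_thm_1`) + `Literature.NumberTheory.EllipticCurves.PAdicBSD`
(`IsCyclotomicVariable`, `iwasawaToPowerSeries`) + `Kobayashi2003.SignedSelmer` (`SignedSelmerDualData`) — all already below `Theses.SignedLowerHalves`'s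
current imports or the vet's `edit_imports.json`; this sketch elaborates with the five imports above. HONEST: nothing here is asserted; the five children are
hypotheses; crux 4 OPEN; BSD not proved.
-/

-- D-0017: single-problem summit, the namespace repeats the problem name by design.
set_option linter.dupNamespace false

namespace Summit.BirchSwinnertonDyer.BirchSwinnertonDyer.Theses.SignedLowerHalves

/-- child 1 (crux; = v13 `stub_ES2rat_ns` T2_rat¬CM,h): the RATIONAL two-variable Euler-system inclusion `∃ a, (p^a·G) ⊆ ch(X_Gr₂)^{ur}` on the
small-image supersingular non-CM domain, Heegner frames WITH `p ∤ h_K`. OPEN / PRE-adjacent. -/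
def SmallImageEulerSystemRatCoprime : Prop :=
  Literature.NumberTheory.EllipticCurves.ModularForms.nonempty_modularParametrizationData → ∀ (W : WeierstrassCurve ℚ) [W.IsElliptic] [W.IsGloballyMinimal] (p : ℕ) [Fact p.Prime], 5 ≤ p → W.HasGoodReductionAtPrime p → W.frobeniusTrace p = 0 → ¬ Literature.NumberTheory.EllipticCurves.Rank1Residual.Surj W p → ¬ W.HasCM → ∀ (K : Type) [Field K] [NumberField K] (ι : PadicAlgCl p ≃+* ℂ) (v vbar : IsDedekindDomain.HeightOneSpectrum (NumberField.RingOfIntegers K)) (κ₁ κ₂ : Literature.NumberTheory.EllipticCurves.ZpExtension K p) (γ₁ γ₂ : Field.absoluteGaloisGroup K) [Fact (Literature.NumberTheory.EllipticCurves.ZpExtension.IsTopGeneratorPair κ₁ κ₂ γ₁ γ₂)] [NeZero (NumberField.discr K).natAbs] (N : ℕ) [NeZero N] (f : CuspForm (CongruenceSubgroup.Gamma0 N) 2), Literature.NumberTheory.EllipticCurves.ModularForms.IsNewformOf W f → (N : ℤ) = W.conductorNorm ℤ → Literature.NumberTheory.EllipticCurves.IsImaginaryQuadratic K → ((Ideal.span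 {(p : ℤ)}).primesOver (NumberField.RingOfIntegers K)).ncard = 2 → ((p : ℕ) : NumberField.RingOfIntegers K) ∈ v.asIdeal → ((p : ℕ) : NumberField.RingOfIntegers K) ∈ vbar.asIdeal → vbar ≠ v → (∀ (w : NumberField.InfinitePlace K) (k : NumberField.RingOfIntegers K), k ∈ v.asIdeal ↔ ‖ι.symm (w.embedding (k : K))‖ < 1) → IsCoprime (N : ℤ) (NumberField.discr K) → (∀ ℓ : ℕ, ℓ.Prime → ℓ ∣ N → ((Ideal.span {(ℓ : ℤ)}).primesOver (NumberField.RingOfIntegers K)).ncard = 2) → Odd (NumberField.discr K) → NumberField.discr K ≠ -3 → κ₁.IsCyclotomic → κ₂.IsAnticyclotomic → ¬ p ∣ NumberField.classNumber K → ∀ (Ω δ : ℂ) (Ωp : (Literature.NumberTheory.EllipticCurves.unrIntegers p)ˣ) (LK G : PowerSeries (PowerSeries (PadicComplexInt p))), Ω ≠ 0 → (δ ^ 2 = (NumberField.discr K : ℂ) ∨ δ ^ 2 = -(NumberField.discr K : ℂ)) → Literature.NumberTheory.EllipticCurves.IsKatzMeasure₂ ι v vbar ∅ κ₁ κ₂ γ₁⁻¹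 γ₂⁻¹ 1 Ω δ ((Ωp : Literature.NumberTheory.EllipticCurves.unrIntegers p) : PadicComplex p) LK → Literature.NumberTheory.EllipticCurves.IsGreenbergLFunctionAnyRoot₂ ι v vbar κ₁ κ₂ γ₁⁻¹ γ₂⁻¹ f (NumberField.discr K).natAbs (NumberField.classNumber K) LK G → ∀ J : ℤ_[p] →+* PadicComplexInt p, (∀ x : ℤ_[p], ((J x : PadicComplexInt p) : PadicComplex p) = ((x : ℚ_[p]) : PadicComplex p)) → ∃ a : ℕ, Ideal.span {((p : ℕ) : PowerSeries (PowerSeries (PadicComplexInt p))) ^ a * G} ≤ (WeierstrassCurve.XGr₂.charIdeal (W.baseChange K) p κ₁ κ₂ vbar γ₁ γ₂).map (Literature.NumberTheory.EllipticCurves.IwasawaAlgebra₂.toUnr₂ p J)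

/-- child 2 (crux; = v13 `stub_acDivRat_ns` T1_rat¬CM,h): the RATIONAL anticyclotomic Eisenstein inclusion on `T₁ = 0`,
`∃ b, (p^b)·ch^{ur}|_{T₁=0} ⊆ (G⁻)`, Heegner frames WITH `p ∤ h_K` (= 20727-coprime's body, `Surj ↦ a_p = 0 → ¬Surj → ¬CM`, × `p^b`). OPEN / PRE-adjacent. -/
def SmallImageAcDivRatCoprime : Prop :=
  Literature.NumberTheory.EllipticCurves.ModularForms.nonempty_modularParametrizationData → ∀ (W : WeierstrassCurve ℚ) [W.IsElliptic] [W.IsGloballyMinimal] (p : ℕ) [Fact p.Prime], 5 ≤ p → W.HasGoodReductionAtPrime p → W.frobeniusTrace p = 0 → ¬ Literature.NumberTheory.EllipticCurves.Rank1Residual.Surj W p → ¬ W.HasCM → ∀ (K : Type) [Field K] [NumberField K] (ι : PadicAlgCl p ≃+* ℂ) (v vbar : IsDedekindDomain.HeightOneSpectrum (NumberField.RingOfIntegers K)) (κ₁ κ₂ : Literature.NumberTheory.EllipticCurves.ZpExtension K p) (γ₁ γ₂ : Field.absoluteGaloisGroup K) [Fact (Literature.NumberTheory.EllipticCurves.ZpExtension.IsTopGeneratorPair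 κ₁ κ₂ γ₁ γ₂)] [NeZero (NumberField.discr K).natAbs] (N : ℕ) [NeZero N] (f : CuspForm (CongruenceSubgroup.Gamma0 N) 2), Literature.NumberTheory.EllipticCurves.ModularForms.IsNewformOf W f → (N : ℤ) = W.conductorNorm ℤ → Literature.NumberTheory.EllipticCurves.IsImaginaryQuadratic K → ((Ideal.span {(p : ℤ)}).primesOver (NumberField.RingOfIntegers K)).ncard = 2 → ((p : ℕ) : NumberField.RingOfIntegers K) ∈ v.asIdeal → ((p : ℕ) : NumberField.RingOfIntegers K) ∈ vbar.asIdeal → vbar ≠ v → (∀ (w : NumberField.InfinitePlace K) (k : NumberField.RingOfIntegers K), k ∈ v.asIdeal ↔ ‖ι.symm (w.embedding (k : K))‖ < 1) → IsCoprime (N : ℤ) (NumberField.discr K) → (∀ ℓ : ℕ, ℓ.Prime → ℓ ∣ N → ((Ideal.span {(ℓ : ℤ)}).primesOver (NumberField.RingOfIntegers K)).ncard = 2) → Odd (NumberField.discr K) → NumberField.discr K ≠ -3 → κ₁.IsCyclotomic → κ₂.IsAnticyclotomic → ¬ p ∣ NumberField.classNumber K → ∀ (Ω δ : ℂ) (Ωp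 : (Literature.NumberTheory.EllipticCurves.unrIntegers p)ˣ) (LK G : PowerSeries (PowerSeries (PadicComplexInt p))), Ω ≠ 0 → (δ ^ 2 = (NumberField.discr K : ℂ) ∨ δ ^ 2 = -(NumberField.discr K : ℂ)) → Literature.NumberTheory.EllipticCurves.IsKatzMeasure₂ ι v vbar ∅ κ₁ κ₂ γ₁⁻¹ γ₂⁻¹ 1 Ω δ ((Ωp : Literature.NumberTheory.EllipticCurves.unrIntegers p) : PadicComplex p) LK → Literature.NumberTheory.EllipticCurves.IsGreenbergLFunctionAnyRoot₂ ι v vbar κ₁ κ₂ γ₁⁻¹ γ₂⁻¹ f (NumberField.discr K).natAbs (NumberField.classNumber K) LK G → ∀ J : ℤ_[p] →+* PadicComplexInt p, (∀ x : ℤ_[p], ((J x : PadicComplexInt p) : PadicComplex p) = ((x : ℚ_[p]) : PadicComplex p)) → ∃ b : ℕ, Ideal.span {((p : ℕ) : PowerSeries (PadicComplexInt p)) ^ b} * ((WeierstrassCurve.XGr₂.charIdeal (W.baseChange K) p κ₁ κ₂ vbar γ₁ γ₂).map (Literature.NumberTheory.EllipticCurves.IwasawaAlgebra₂.toUnr₂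 p J)).map (PowerSeries.constantCoeff (R := PowerSeries (PadicComplexInt p))) ≤ Ideal.span {Literature.NumberTheory.EllipticCurves.UnrSeries₂.minus G}

/-- child 3 (crux; = v13 `stub_muOneSign_ns_ge5`, unchanged since v6): at `p ≥ 5`, for the conductor-level newform SOME signed Pollack function has
unit content (OPEN class-wide = OS₀(N,p); in the tree ⟸ B⁰ / B⁰_ss / B⁰ mod heckeRelators at the pair's level; PROVED input-free at `p = 3`). -/
def SmallImageOneSignUnitContent : Prop :=
  ∀ (W : WeierstrassCurve ℚ) [W.IsElliptic] [W.IsGloballyMinimal] (p : ℕ) [Fact p.Prime], 5 ≤ p → Literature.NumberTheory.EllipticCurves.Rank1Residual.ClassX7 W p → ¬ W.HasCM → W.frobeniusTrace p = 0 → ¬ Literature.NumberTheory.EllipticCurves.Rank1Residual.Surj W p → ∀ [NeZero (W.conductorNorm ℤ)] (f : CuspForm (CongruenceSubgroup.Gamma0 (W.conductorNorm ℤ)) 2), Literature.NumberTheory.EllipticCurves.ModularForms.IsNewformOf W f → ∃ (ε₀ : ℤˣ) (L₀ : Literature.NumberTheory.EllipticCurves.IwasawaAlgebra p), Literature.NumberTheory.EllipticCurves.Kobayashi2003.IsSignedPAdicLFunction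 f p ε₀ L₀ ∧ Literature.NumberTheory.EllipticCurves.GreenbergVatsal2000.HasUnitContent L₀

/-- child 4 (crux; = v12/v13 `stub_lambdaLowerThree_ns`): the `p`-INVERTED signed lower divisibility at `3`, BOTH signs, on the crux's `p = 3` rows
(= crux 3's `LambdaLowerDivisibility W 3 ε` unfolded, `¬Surj` binder). OPEN / PRE-adjacent. -/
def SmallImageLambdaLowerAtThree : Prop :=
  ∀ (W : WeierstrassCurve ℚ) [W.IsElliptic] [W.IsGloballyMinimal] (p : ℕ) [Fact p.Prime], p = 3 → Literature.NumberTheory.EllipticCurves.Rank1Residual.ClassX7 W p → ¬ W.HasCM → W.frobeniusTrace p = 0 → ¬ Literature.NumberTheory.EllipticCurves.Rank1Residual.Surj W p → ∀ (ε : ℤˣ) (κ : Literature.NumberTheory.EllipticCurves.ZpExtension ℚ p) (γ : Field.absoluteGaloisGroup ℚ), κ.IsCyclotomic → κ.IsTopGenerator γ → Literature.NumberTheory.EllipticCurves.IsCyclotomicVariable p γ → ∀ [NeZero (W.conductorNorm ℤ)] (f : CuspForm (CongruenceSubgroup.Gamma0 (W.conductorNorm ℤ)) 2), Literature.NumberTheory.EllipticCurves.ModularForms.IsNewformOf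 W f → ∀ (ϖ : ℚ), (ϖ : ℝ) * W.realPeriodRat = Literature.NumberTheory.EllipticCurves.ModularForms.plusPeriod f → ∀ (Lplus Lminus : Literature.NumberTheory.EllipticCurves.IwasawaAlgebra p), Summit.BirchSwinnertonDyer.Rank1Residual.Supersingular.IsPollackPair f p Lplus Lminus → ∀ (D : Literature.NumberTheory.EllipticCurves.Kobayashi2003.SignedSelmerDualData W κ γ ε), ∃ (g h : Literature.NumberTheory.EllipticCurves.IwasawaAlgebra p) (m : ℕ), D.charIdeal = Ideal.span {g} ∧ Literature.NumberTheory.EllipticCurves.iwasawaToPowerSeries p (PowerSeries.C ((p : ℤ_[p]) ^ m) * g) = PowerSeries.C (ϖ : ℚ_[p]) * Literature.NumberTheory.EllipticCurves.iwasawaToPowerSeries p (Summit.BirchSwinnertonDyer.Rank1Residual.Supersingular.kobayashiL ε Lplus Lminus * h)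

/-- child 5 (support, HELD/PRE cite bundle; = v13 `stub_publishedInputs_ns ∧ stub_preprintInputs_ns`): five prints ∧ Mazur 1978 Cor. 4.1 ∧
Beckwith–Raum–Richter 2022 Thm. 1, and the two BSTW-PRE binders. Nothing asserted. -/
def SmallImagePublishedPreprintInputs : Prop :=
  ((Literature.NumberTheory.EllipticCurves.Kobayashi2003.thm41_signedCharIdeal_divisibility ∧ Literature.NumberTheory.EllipticCurves.Kobayashi2003.thm12_signedSelmerDual_finite_torsion ∧ Literature.NumberTheory.EllipticCurves.Kobayashi2003.thm62_63_73_signedColemanKato_zeta ∧ Literature.NumberTheory.EllipticCurves.ModularForms.nonempty_modularParametrizationData ∧ Literature.NumberTheory.EllipticCurves.BurungaleCastellaSkinner2025.prop422_greenbergAnyRoot_hasUnitContent_minus) ∧ Literature.NumberTheory.EllipticCurves.ModularForms.mazur_not_dvd_maninConstant_of_odd ∧ Literature.NumberTheory.QuadraticFields.BRR2022_thm_1) ∧ (Literature.NumberTheory.EllipticCurves.BurungaleSkinnerTianWan2024.thm617_exists_commonKatzFrame_isGreenbergLFunctionAnyRoot₂_supersingular_PRE ∧ Literature.NumberTheory.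EllipticCurves.BurungaleSkinnerTianWan2024.props118_27_519_exists_signedTwoVariablePackage_supersingular_PRE)

/-- glue statement of the split (turnkey #2 v3). -/
def KobayashiMainConjectureSmallImageOfAcnsPartsCoprime : Prop :=
  SmallImageEulerSystemRatCoprime → SmallImageAcDivRatCoprime → SmallImageOneSignUnitContent → SmallImageLambdaLowerAtThree →
    SmallImagePublishedPreprintInputs → KobayashiMainConjectureSmallImage

section Glue
open CongruenceSubgroup Literature.NumberTheory.EllipticCurves Literature.NumberTheory.EllipticCurves.Rank1Residual
  Literature.NumberTheory.EllipticCurves.ModularForms Literature.NumberTheory.EllipticCurves.Kobayashi2003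
  Literature.NumberTheory.EllipticCurves.GreenbergVatsal2000
  Literature.NumberTheory.EllipticCurves.BurungaleSkinnerTianWan2024
  Literature.NumberTheory.EllipticCurves.BurungaleCastellaSkinner2025
  Summit.BirchSwinnertonDyer.Rank1Residual.Supersingular

set_option maxHeartbeats 800000 in
/-- the one-sign unit-content rider at every odd `p` from child 3 (`p ≥ 5`) and the PROVED `p = 3` twin
(= `BirthAcns.muOneSign_of_stubs` with the stub as a hypothesis; pen g35's v2 proof verbatim). -/
theorem oneSignUnitContent_of_child_v3 (h3 : SmallImageOneSignUnitContent) :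
    ∀ (W : WeierstrassCurve ℚ) [W.IsElliptic] [W.IsGloballyMinimal] (p : ℕ) [Fact p.Prime],
      p ≠ 2 → ClassX7 W p → ¬ W.HasCM → W.frobeniusTrace p = 0 → ¬ Surj W p →
      ∀ [NeZero (W.conductorNorm ℤ)] (f : CuspForm (Gamma0 (W.conductorNorm ℤ)) 2),
      IsNewformOf W f → ∃ (ε₀ : ℤˣ) (L₀ : IwasawaAlgebra p),
        IsSignedPAdicLFunction f p ε₀ L₀ ∧ HasUnitContent L₀ := by
  intro W _ _ p _ hp2 hX hCM hap hs _ f hf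
  have hpP : p.Prime := Fact.out
  by_cases h3p : p = 3
  · subst h3p
    obtain ⟨n, u, hunit⟩ :=
      Summit.BirchSwinnertonDyer.BirchSwinnertonDyer.Theorems.SmallImageCycWindingMuThree.exists_unit_norm_ratPlusSymbol_three_eq_one_of_isNewformOf
        f hf hX.1.1 hap
    exact Summit.BirchSwinnertonDyer.BirchSwinnertonDyer.Theorems.SmallImageOrbitSumMuThree.exists_sign_hasUnitContent_three_of_norm_ratPlusSymbol_eq_one
      f hf hX.1.1 hap u hunit
  · have h5 : 5 ≤ p := by
      rcases hpP.eq_two_or_odd' with h | h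
      · exact absurd h hp2
      · have h2 := hpP.two_le
        by_contra hlt
        interval_cases p <;> simp_all (config := {decide := true})
    exact h3 W p h5 hX hCM hap hs f hf

/-- the integral `∃ ε` Eisenstein half at `3` (v11 child 4 `SmallImageLowerHalfAtThree`) DERIVED from child 4 (λ-part, both signs) and the period unit
`h3` (= `BirthAcns.threeLower_of_stubs` with the stub as a hypothesis). -/
theorem lowerHalfAtThree_of_child_v3 (h4 : SmallImageLambdaLowerAtThree)
    (h3 : Literature.NumberTheory.EllipticCurves.realPeriodRat_eq_unit_mul_plusPeriod_three) :
    ∀ (W : WeierstrassCurve ℚ) [W.IsElliptic] [W.IsGloballyMinimal] (p : ℕ) [Fact p.Prime],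
      p = 3 → ClassX7 W p → ¬ W.HasCM → W.frobeniusTrace p = 0 → ¬ Surj W p →
      ∃ ε : ℤˣ, Summit.BirchSwinnertonDyer.Rank1Residual.Supersingular.KobayashiLowerDivisibility W p ε := by
  intro W _ _ p _ hp3 hX hCM hap hs
  subst hp3
  exact Summit.BirchSwinnertonDyer.BirchSwinnertonDyer.Theorems.HorocycleMuFloor.X7.exists_kobayashiLowerDivisibility_three_of_pInverted
    W h3 hX hap (fun ε ↦ h4 W 3 rfl hX hCM hap hs ε)

set_option maxHeartbeats 800000 in
/-- crux 4 from the five v3 children (= `BirthAcns.KobayashiMainConjectureSmallImage_of` (v13) with the stubs as hypotheses). -/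
theorem kobayashiMainConjectureSmallImage_of_children_v3 (h1 : SmallImageEulerSystemRatCoprime) (h2 : SmallImageAcDivRatCoprime)
    (h3 : SmallImageOneSignUnitContent) (h4 : SmallImageLambdaLowerAtThree) (h5 : SmallImagePublishedPreprintInputs) :
    KobayashiMainConjectureSmallImage := by
  obtain ⟨h41, h12, h5r, h3r, hCK, hmodP, h422⟩ :=
    Summit.BirchSwinnertonDyer.BirchSwinnertonDyer.Theorems.SignedLowerHalves.InputsPublishedNs.publishedInputs_ns_of_five_of_mazur
      h5.1.1 h5.1.2.1
  exact Summit.BirchSwinnertonDyer.BirchSwinnertonDyer.Theorems.SmallImageAcnsCrux.kobayashiMainConjectureSmallImage_of_acns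
    hCK h12 h41 h5r h3r hmodP h422 h5.2.2 h5.2.1
    (Summit.BirchSwinnertonDyer.BirchSwinnertonDyer.Theorems.SmallImageAcanchorGlueRatRatNotCMCoprime.canonicalNs_of_eulerSystemRatNotCMCoprime_of_acDivRatNotCMCoprime_noSurj
      h5.1.2.2 h1 h2)
    (oneSignUnitContent_of_child_v3 h3) (lowerHalfAtThree_of_child_v3 h4 h3r)

/-- the glue item of the v3 split, PROVED. -/
theorem kobayashiMainConjectureSmallImageOfAcnsPartsCoprime_holds : KobayashiMainConjectureSmallImageOfAcnsPartsCoprime :=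
  fun h1 h2 h3 h4 h5 => kobayashiMainConjectureSmallImage_of_children_v3 h1 h2 h3 h4 h5

end Glue

end Summit.BirchSwinnertonDyer.BirchSwinnertonDyer.Theses.SignedLowerHalves
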